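import Literature.NumberTheory.PAdicHodge.EisensteinRootShortModel
import Literature.NumberTheory.PAdicHodge.AinfWeierstrassTateModuleGeom
import HarnessLib

/-!
# The CM fibres `E₀ ∈ {y² = x³ + a x, y² = x³ + b}` of the K★ cell models: good SUPERSINGULAR data at `p ∈ {5, 7}` in the currency of the
# transported reciprocity law (`p ∤ Δ(E₀)`, `A_p(E₀ mod p) = 0`, ellipticity over `ℚ_p`, `𝔽_p`, `ℂ_F`)

Topic `Literature/NumberTheory/PAdicHodge`; namespace `Literature.NumberTheory.PAdicHodge`. THEOREMS ONLY (no definition, no named fact, no instance, no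
`sorry`). The special fibre of the cell model `W_D = ⟨0,0,0,a ϱ^{r₄}, b ϱ^{r₆}⟩` at `ϱ = 0` is the `ℤ`-curve
`E₀ = ⟨0, 0, 0, (r₄ = 0 ? a : 0), (r₆ = 0 ? b : 0)⟩` (`AinfRamifiedDivisionTransport.map_explicitModel_eq_map_cmFibre`); for the three potentially
supersingular cells `(p; r₄, r₆) ∈ {(5; >0, 0), (7; 0, >0)}` this is `y² = x³ + b` (`j = 0`, supersingular at `5 ≡ 2 (3)`) resp. `y² = x³ + a x`
(`j = 1728`, supersingular at `7 ≡ 3 (4)`). This file provides the FIVE `E₀`-hypotheses of `BmaxPlusTransportedReciprocity(FormalPoint|Transport)` /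
`Summits/…/…TransportedReciprocity(AllPoints|Transport|OfVariableChange)` for them:

* `map_cmFibre` (`E₀ ⊗ R = ⟨0,0,0,·,·⟩`), `Δ_cmFibre_five` / `Δ_cmFibre_seven` (`Δ = −432b²` / `−64a³`);
* ★ `hasseCoeff_cmFibre_eq_zero` — `A_p(E₀ mod p) = 0` (`hasseCoeff_five_short` / `hasseCoeff_seven_short`);
* ★ `not_dvd_Δ_cmFibre` — `p ∤ Δ(E₀)` from `p ∤ b` (at `5`) / `p ∤ a` (at `7`); `not_dvd_of_isUnit_cells` derives these from the cells' unit
  `64a³p^{t₄} + 432b²p^{t₆} ∈ ℤ_pˣ` (`t₄ > 0 = t₆` at `5`, `t₄ = 0 < t₆` at `7`);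
* `isElliptic_cmFibre_map_field` (e.g. `ℚ_p`), `isElliptic_cmFibre_map_zmod`, `isElliptic_curveOver_cmFibre` — the three ellipticity instances.

Purpose: crux K★ `stmt-BirchSwinnertonDyer-22226` (route `EdixhovenFibreFiveSeven`, line `kato_lever`), memo
`Summits/…/Cruxes/StarredOptimalManinUnitFiveSeven/Lines/kato-lever-K2-transport-allpoints.md` §2. Infrastructure only; BSD / K★ are not proved by this.

## References
* J. H. Silverman, *AEC* (2009), III.1, V.4.1 (Deuring's criterion), Ex. V.5.7–5.8 (`j = 0, 1728`). [SilvermanAEC2009]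
-/

noncomputable section

open scoped Classical
open Polynomial

namespace Literature.NumberTheory.PAdicHodge

open Literature.NumberTheory.EllipticCurves

section CMFibre

variable {p : ℕ} [Fact p.Prime] (a b : ℤ) (r₄ r₆ : ℕ)

/-- `E₀ ⊗ R = ⟨0, 0, 0, f(·), f(·)⟩` for the CM fibre. [cite: SilvermanAEC2009, III.1] -/
theorem map_cmFibre {R : Type*} [CommRing R] (f : ℤ →+* R) :
    ((⟨0, 0, 0, if r₄ = 0 then a else 0, if r₆ = 0 then b else 0⟩ : WeierstrassCurve ℤ).map f) =
      ⟨0, 0, 0, f (if r₄ = 0 then a else 0), f (if r₆ = 0 then b else 0)⟩ := by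
  simp only [WeierstrassCurve.map, map_zero]

/-- `Δ(E₀) = −432 b²` on the cells at `5` (`r₄ > 0 = r₆`: `E₀ = y² = x³ + b`). [cite: SilvermanAEC2009, III.1 (p. 42)] -/
theorem Δ_cmFibre_five (hr₄ : 0 < r₄) (hr₆ : r₆ = 0) :
    ((⟨0, 0, 0, if r₄ = 0 then a else 0, if r₆ = 0 then b else 0⟩ : WeierstrassCurve ℤ)).Δ = -(432 * b ^ 2) := by
  rw [if_neg hr₄.ne', if_pos hr₆, Δ_short]; ring

/-- `Δ(E₀) = −64 a³` on the cell at `7` (`r₄ = 0 < r₆`: `E₀ = y² = x³ + a x`). [cite: SilvermanAEC2009, III.1 (p. 42)] -/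
theorem Δ_cmFibre_seven (hr₄ : r₄ = 0) (hr₆ : 0 < r₆) :
    ((⟨0, 0, 0, if r₄ = 0 then a else 0, if r₆ = 0 then b else 0⟩ : WeierstrassCurve ℤ)).Δ = -(64 * a ^ 3) := by
  rw [if_pos hr₄, if_neg hr₆.ne', Δ_short]; ring

/-- ★ **`A_p(E₀ mod p) = 0`** on the three potentially supersingular cells: `A_5(y² = x³ + b̄) = 32·0`, `A_7(y² = x³ + ā x) = 192·0`
(Deuring). [cite: SilvermanAEC2009, V.4.1 and Ex. V.5.7] -/
theorem hasseCoeff_cmFibre_eq_zero (hp57 : p = 5 ∨ p = 7) (hr₄ : p = 5 → 0 < r₄) (hr₆ : p = 7 → 0 < r₆) :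
    ((⟨0, 0, 0, if r₄ = 0 then a else 0, if r₆ = 0 then b else 0⟩ : WeierstrassCurve ℤ).map (Int.castRingHom (ZMod p))).hasseCoeff p = 0 := by
  rw [map_cmFibre]
  rcases hp57 with rfl | rfl
  · rw [hasseCoeff_five_short, if_neg (hr₄ rfl).ne', map_zero, mul_zero]
  · rw [hasseCoeff_seven_short, if_neg (hr₆ rfl).ne', map_zero, mul_zero]

/-- ★ **`p ∤ Δ(E₀)`** on the cells: at `5` from `5 ∤ b` (`Δ = −432b²`, `5 ∤ 432`), at `7` from `7 ∤ a` (`Δ = −64a³`, `7 ∤ 64`).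
[cite: SilvermanAEC2009, III.1 and VII.5] -/
theorem not_dvd_Δ_cmFibre (hp57 : p = 5 ∨ p = 7) (hr : (p = 5 → 0 < r₄ ∧ r₆ = 0) ∧ (p = 7 → r₄ = 0 ∧ 0 < r₆))
    (hb : p = 5 → ¬ (p : ℤ) ∣ b) (ha : p = 7 → ¬ (p : ℤ) ∣ a) :
    ¬ (p : ℤ) ∣ ((⟨0, 0, 0, if r₄ = 0 then a else 0, if r₆ = 0 then b else 0⟩ : WeierstrassCurve ℤ)).Δ := by
  rcases hp57 with rfl | rfl
  · obtain ⟨h₄, h₆⟩ := hr.1 rfl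
    rw [Δ_cmFibre_five a b r₄ r₆ h₄ h₆, dvd_neg]
    intro h
    have h5 : Prime ((5 : ℕ) : ℤ) := Nat.prime_iff_prime_int.mp (by norm_num)
    rcases h5.dvd_or_dvd h with h' | h'
    · norm_num at h'
    · exact hb rfl (h5.dvd_of_dvd_pow h')
  · obtain ⟨h₄, h₆⟩ := hr.2 rfl
    rw [Δ_cmFibre_seven a b r₄ r₆ h₄ h₆, dvd_neg]
    intro h
    have h7 : Prime ((7 : ℕ) : ℤ) := Nat.prime_iff_prime_int.mp (by norm_num)
    rcases h7.dvd_or_dvd h with h' | h'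
    · norm_num at h'
    · exact ha rfl (h7.dvd_of_dvd_pow h')

/-- **`p ∤ b` at `5`, `p ∤ a` at `7` from the cells' unit `64a³p^{t₄} + 432b²p^{t₆} ∈ ℤ_pˣ`** (`t₄ > 0 = t₆` at `5`: the unit is `≡ 432 b²`;
`t₄ = 0 < t₆` at `7`: `≡ 64 a³`). [cite: SilvermanAEC2009, VII.5.5] -/
theorem not_dvd_of_isUnit_cells (hp57 : p = 5 ∨ p = 7) {t₄ t₆ : ℕ} (ht : (p = 5 → 0 < t₄ ∧ t₆ = 0) ∧ (p = 7 → t₄ = 0 ∧ 0 < t₆))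
    (hu : IsUnit (64 * (a : ℤ_[p]) ^ 3 * (p : ℤ_[p]) ^ t₄ + 432 * (b : ℤ_[p]) ^ 2 * (p : ℤ_[p]) ^ t₆)) :
    (p = 5 → ¬ (p : ℤ) ∣ b) ∧ (p = 7 → ¬ (p : ℤ) ∣ a) := by
  -- a unit of `ℤ_p` is not in `pℤ_p`; a sum `x + y` with `y ∈ pℤ_p` is a unit iff `x` is
  have key : ∀ (x y : ℤ_[p]), IsUnit (x + (p : ℤ_[p]) * y) → IsUnit x := fun x y h => by
    by_contra hx
    have hxm : x ∈ IsLocalRing.maximalIdeal ℤ_[p] := (IsLocalRing.mem_maximalIdeal _).2 hx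
    have hym : (p : ℤ_[p]) * y ∈ IsLocalRing.maximalIdeal ℤ_[p] := by
      rw [PadicInt.maximalIdeal_eq_span_p]; exact Ideal.mul_mem_right _ _ (Ideal.mem_span_singleton_self _)
    exact (IsLocalRing.mem_maximalIdeal _).1 (Ideal.add_mem _ hxm hym) h
  have hint : ∀ (n : ℤ) (k : ℕ) (c : ℤ_[p]), IsUnit ((c * (n : ℤ_[p]) ^ k)) → 0 < k → ¬ (p : ℤ) ∣ n := fun n k c h hk hdvd => by
    have hn : ¬ IsUnit ((n : ℤ_[p])) := fun hu' => by
      have := PadicInt.isUnit_iff.1 hu'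
      exact absurd this (ne_of_lt ((PadicInt.norm_int_lt_one_iff_dvd n).2 hdvd))
    exact hn (isUnit_of_dvd_unit (dvd_mul_of_dvd_right (dvd_pow_self _ hk.ne') _) h)
  rcases hp57 with rfl | rfl
  · obtain ⟨h₄, h₆⟩ := ht.1 rfl
    refine ⟨fun _ => ?_, fun h => by norm_num at h⟩
    rw [h₆, pow_zero, mul_one] at hu
    obtain ⟨t, rfl⟩ : ∃ t, t₄ = t + 1 := ⟨t₄ - 1, by omega⟩
    have hu' : IsUnit (432 * (b : ℤ_[5]) ^ 2 + ((5 : ℕ) : ℤ_[5]) * (64 * (a : ℤ_[5]) ^ 3 * ((5 : ℕ) : ℤ_[5]) ^ t)) := by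
      convert hu using 1; ring
    exact hint b 2 432 (key _ _ hu') two_pos
  · obtain ⟨h₄, h₆⟩ := ht.2 rfl
    refine ⟨fun h => by norm_num at h, fun _ => ?_⟩
    rw [h₄, pow_zero, mul_one] at hu
    obtain ⟨t, rfl⟩ : ∃ t, t₆ = t + 1 := ⟨t₆ - 1, by omega⟩
    have hu' : IsUnit (64 * (a : ℤ_[7]) ^ 3 + ((7 : ℕ) : ℤ_[7]) * (432 * (b : ℤ_[7]) ^ 2 * ((7 : ℕ) : ℤ_[7]) ^ t)) := by
      convert hu using 1; ring
    exact hint a 3 64 (key _ _ hu') three_pos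

/-- **`E₀ ⊗ K` is elliptic over any field of characteristic `0`** (`Δ(E₀) ≠ 0`). [cite: SilvermanAEC2009, III.1] -/
theorem isElliptic_cmFibre_map_field {K : Type*} [Field K] [CharZero K] (E₀ : WeierstrassCurve ℤ) (hΔ : E₀.Δ ≠ 0) :
    (E₀.map (Int.castRingHom K)).IsElliptic :=
  ⟨by
    rw [WeierstrassCurve.map_Δ, eq_intCast]
    exact isUnit_iff_ne_zero.2 (by exact_mod_cast hΔ)⟩

/-- **`E₀ ⊗ 𝔽_p` is elliptic when `p ∤ Δ(E₀)`.** [cite: SilvermanAEC2009, VII.5] -/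
theorem isElliptic_cmFibre_map_zmod (E₀ : WeierstrassCurve ℤ) (hΔ : ¬ (p : ℤ) ∣ E₀.Δ) :
    (E₀.map (Int.castRingHom (ZMod p))).IsElliptic :=
  ⟨by
    rw [WeierstrassCurve.map_Δ, eq_intCast]
    exact isUnit_iff_ne_zero.2 fun h => hΔ ((ZMod.intCast_zmod_eq_zero_iff_dvd _ _).1 h)⟩

end CMFibre

section OverC

variable {F : Type} [Field F] [ValuativeRel F] [TopologicalSpace F] [IsNonarchimedeanLocalField F] [CharZero F]

/-- **`E₀ ⊗ ℂ_F` (`curveOver`) is elliptic when `Δ(E₀) ≠ 0`** (`AinfTop.isElliptic_curveOverC`). [cite: SilvermanAEC2009, III.1] -/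
theorem isElliptic_curveOver_cmFibre (E₀ : WeierstrassCurve ℤ) (hΔ : E₀.Δ ≠ 0) :
    (curveOver (CompletedAlgClosure F) E₀).IsElliptic :=
  AinfTop.isElliptic_curveOverC (F := F) E₀ hΔ

end OverC

end Literature.NumberTheory.PAdicHodge

end
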